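import Mathlib
import HarnessLib
import Literature.NumberTheory.Transcendental.KZCalculus
import Literature.NumberTheory.Transcendental.KZLogCalculusProofs
import Literature.NumberTheory.Transcendental.KZUnfoldedStokesProofs
import Literature.NumberTheory.Transcendental.SemialgebraicLineDeriv
import Summits.KontsevichZagierPeriods.KontsevichZagierPeriods.Theorems.MzvKernelInKZTwoPosetsCubicalChart
import Summits.KontsevichZagierPeriods.KontsevichZagierPeriods.Theorems.MzvKernelInKZ.Negative.WeightsTwoThree
import Summits.KontsevichZagierPeriods.KontsevichZagierPeriods.Theorems.LinRedNormalFormDihedralNormalFormStubTorusDescentAux1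

/-!
# Stub `stub_exactToFacesTwo` of line `tame-bv-stokes` (crux `DihedralNormalForm`) — tools I

Support file for the stub `stub_exactToFacesTwo` (dimension two of the descent of cubical
representations by bounded Stokes moves). Everything in the stub is phrased through ONE family of
functions on `ℝ²` (written out in full in every statement; in the docstrings we abbreviate)

  `GEN(k, a, b, P, R, m) = fun x => k · x₀^a · x₁^b · (1 - x₀)^P · (1 - x₁)^R · (1 - x₀x₁)^m`

(`k ∈ ℚ`, `a b P R ∈ ℕ`, `m ∈ ℤ`, Mathlib's junk value `0⁻¹ = 0` at the corner `x₀x₁ = 1` when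
`m < 0`): the cubical atoms of dimension two are these functions on the open square
`KZ.unitCube 2`, and so are all the primitives of the Stokes moves of the stub. This file proves
the analytic facts about them:

* `ℚ`-semialgebraicity on any set, composed with coordinatewise semialgebraic maps
  (`facesTwo_gen_comp`), in particular on the closed and on the open square;
* the bound `|GEN| ≤ |k|` on the CLOSED square as soon as `P + R + m ≥ 0`
  (`facesTwo_gen_abs_le`; key inequality `1 - x₀, 1 - x₁ ≤ 1 - x₀x₁ ≤ 1`);
* differentiability on the open square, continuity of the two coordinate fibres on `[0,1]`;
* absolute integrability on the open square as soon as `m ≥ -(P + R + 1)`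
  (`facesTwo_gen_integrableOn`: domination by `|k|/(1 - x₀x₁)`, integrable by the cubical chart of
  `ζ(2)`, `TwoPosets.stub_cubicalChart`); registered sub-goal `stub_exactToFacesTwoAux1`;
* the two partial derivatives on the open square, again combinations of three `GEN`s
  (`facesTwo_gen_fderiv0`, `facesTwo_gen_fderiv1`).

References: M. Kontsevich, D. Zagier, *Periods* (2001), §1.2.
-/

noncomputable section

open MeasureTheory Set
open Literature.NumberTheory.Transcendental
open Literature.ModelTheory.ExponentialFields (IsSemialgebraic)
open Summit.KontsevichZagierPeriods.MzvKernelInKZ.Negative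
open Summit.KontsevichZagierPeriods.MzvKernelInKZ.TwoPosets

namespace Summit.KontsevichZagierPeriods.DihedralNormalForm.TameBVStokes

/-! ### The squares -/

/-- The closed square `{x | ∀ i, x i ∈ [0,1]}` is `ℚ`-semialgebraic. -/
theorem facesTwo_isSemialgebraic_S2 :
    IsSemialgebraic ℚ {x : Fin 2 → ℝ | ∀ i, x i ∈ Set.Icc (0:ℝ) 1} := by
  have h : {x : Fin 2 → ℝ | ∀ i, x i ∈ Set.Icc (0:ℝ) 1} = closedUnitCube 2 :=
    Set.ext fun _ => mem_closedUnitCube_iff.symm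
  rw [h]
  exact isSemialgebraic_closedUnitCube

/-- The open square lies in the closed square. -/
theorem facesTwo_Q2_subset_S2 : KZ.unitCube 2 ⊆ {x : Fin 2 → ℝ | ∀ i, x i ∈ Set.Icc (0:ℝ) 1} :=
  fun _ hx i => Ioo_subset_Icc_self (hx i)

/-- On the open square `0 < 1 - x₀x₁`. -/
theorem facesTwo_w_pos {x : Fin 2 → ℝ} (hx : x ∈ KZ.unitCube 2) : 0 < 1 - x 0 * x 1 := by
  have h0 := hx 0
  have h1 := hx 1
  nlinarith [h0.1, h0.2, h1.1, h1.2]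

/-- The coordinate functions are `ℚ`-semialgebraic on every `ℚ`-semialgebraic set. -/
theorem facesTwo_coord_sa {d : ℕ} {W : Set (Fin d → ℝ)} (hW : IsSemialgebraic ℚ W) (i : Fin d) :
    IsSemialgebraicFunOn ℚ W fun x => x i :=
  (isSemialgebraicFunOn_aeval hW (MvPolynomial.X i)).congr fun x _ => by simp

/-! ### Semialgebraicity of `GEN` -/

/-- `GEN ∘ X` is `ℚ`-semialgebraic when the two coordinates of `X` are. -/
theorem facesTwo_gen_comp {d : ℕ} {W : Set (Fin d → ℝ)} (hW : IsSemialgebraic ℚ W) (k : ℚ)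
    (a b P R : ℕ) (m : ℤ) {X : (Fin d → ℝ) → (Fin 2 → ℝ)}
    (hX : ∀ i, IsSemialgebraicFunOn ℚ W fun x => X x i) :
    IsSemialgebraicFunOn ℚ W fun x => (k : ℝ) * ((X x) 0 ^ a * (X x) 1 ^ b * (1 - (X x) 0) ^ P *
      (1 - (X x) 1) ^ R * (1 - (X x) 0 * (X x) 1) ^ m) := by
  have h1 : IsSemialgebraicFunOn ℚ W fun _ => (1 : ℝ) := by
    simpa using isSemialgebraicFunOn_const_ratCast hW 1
  refine (isSemialgebraicFunOn_const_ratCast hW k).fun_mul ?_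
  refine ((((((hX 0).fun_pow a).fun_mul ((hX 1).fun_pow b)).fun_mul
    ((h1.fun_sub (hX 0)).fun_pow P)).fun_mul ((h1.fun_sub (hX 1)).fun_pow R)).fun_mul ?_)
  exact TorusDescent.fun_zpow (h1.fun_sub ((hX 0).fun_mul (hX 1))) m

/-- `GEN` is `ℚ`-semialgebraic on the closed square. -/
theorem facesTwo_gen_sa_S2 (k : ℚ) (a b P R : ℕ) (m : ℤ) :
    IsSemialgebraicFunOn ℚ {x : Fin 2 → ℝ | ∀ i, x i ∈ Set.Icc (0:ℝ) 1} (fun x => (k : ℝ) *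
      (x 0 ^ a * x 1 ^ b * (1 - x 0) ^ P * (1 - x 1) ^ R * (1 - x 0 * x 1) ^ m)) :=
  facesTwo_gen_comp facesTwo_isSemialgebraic_S2 k a b P R m (X := fun x => x)
    (facesTwo_coord_sa facesTwo_isSemialgebraic_S2)

/-- `GEN` is `ℚ`-semialgebraic on the open square. -/
theorem facesTwo_gen_sa_Q2 (k : ℚ) (a b P R : ℕ) (m : ℤ) :
    IsSemialgebraicFunOn ℚ (KZ.unitCube 2) (fun x => (k : ℝ) *
      (x 0 ^ a * x 1 ^ b * (1 - x 0) ^ P * (1 - x 1) ^ R * (1 - x 0 * x 1) ^ m)) :=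
  facesTwo_gen_comp (KZ.isSemialgebraic_unitCube 2) k a b P R m (X := fun x => x)
    (facesTwo_coord_sa (KZ.isSemialgebraic_unitCube 2))

/-! ### Bounds -/

/-- The core inequality: for `x₀, x₁ ∈ [0,1]` with `w = 1 - x₀x₁ > 0`, the product
`x₀^a x₁^b (1-x₀)^P (1-x₁)^R w^m` is non-negative and at most `w^{P+R+m}`
(`1 - x₀ ≤ w`, `1 - x₁ ≤ w`). -/
theorem facesTwo_core_bounds (a b P R : ℕ) (m : ℤ) {x : Fin 2 → ℝ} (h0 : x 0 ∈ Icc (0:ℝ) 1)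
    (h1 : x 1 ∈ Icc (0:ℝ) 1) (hw : 0 < 1 - x 0 * x 1) :
    0 ≤ x 0 ^ a * x 1 ^ b * (1 - x 0) ^ P * (1 - x 1) ^ R * (1 - x 0 * x 1) ^ m ∧
    x 0 ^ a * x 1 ^ b * (1 - x 0) ^ P * (1 - x 1) ^ R * (1 - x 0 * x 1) ^ m ≤
      (1 - x 0 * x 1) ^ ((P : ℤ) + R + m) := by
  have ha : 0 ≤ x 0 ^ a := pow_nonneg h0.1 a
  have hb : 0 ≤ x 1 ^ b := pow_nonneg h1.1 b
  have hP : 0 ≤ (1 - x 0) ^ P := pow_nonneg (sub_nonneg.2 h0.2) P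
  have hR : 0 ≤ (1 - x 1) ^ R := pow_nonneg (sub_nonneg.2 h1.2) R
  have hm : 0 ≤ (1 - x 0 * x 1) ^ m := zpow_nonneg hw.le m
  refine ⟨by positivity, ?_⟩
  have ha1 : x 0 ^ a ≤ 1 := pow_le_one₀ h0.1 h0.2
  have hb1 : x 1 ^ b ≤ 1 := pow_le_one₀ h1.1 h1.2
  have hP1 : (1 - x 0) ^ P ≤ (1 - x 0 * x 1) ^ P :=
    pow_le_pow_left₀ (sub_nonneg.2 h0.2) (by nlinarith [h0.1, h1.2]) P
  have hR1 : (1 - x 1) ^ R ≤ (1 - x 0 * x 1) ^ R :=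
    pow_le_pow_left₀ (sub_nonneg.2 h1.2) (by nlinarith [h1.1, h0.2]) R
  have hwP : 0 ≤ (1 - x 0 * x 1) ^ P := pow_nonneg hw.le P
  have hwR : 0 ≤ (1 - x 0 * x 1) ^ R := pow_nonneg hw.le R
  calc x 0 ^ a * x 1 ^ b * (1 - x 0) ^ P * (1 - x 1) ^ R * (1 - x 0 * x 1) ^ m
      ≤ 1 * 1 * (1 - x 0 * x 1) ^ P * (1 - x 0 * x 1) ^ R * (1 - x 0 * x 1) ^ m := by
        gcongr
    _ = (1 - x 0 * x 1) ^ ((P : ℤ) + R + m) := by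
        rw [one_mul, one_mul, zpow_add₀ hw.ne', zpow_add₀ hw.ne', zpow_natCast, zpow_natCast]

/-- **Boundedness on the closed square**: `|GEN(k, a, b, P, R, m)| ≤ |k|` on `[0,1]²` as soon
as `P + R + m ≥ 0` (at the corner `x₀x₁ = 1` the junk value of a negative power is `0`). -/
theorem facesTwo_gen_abs_le (k : ℚ) (a b P R : ℕ) (m : ℤ) (h : 0 ≤ (P : ℤ) + R + m) :
    ∀ x ∈ {x : Fin 2 → ℝ | ∀ i, x i ∈ Set.Icc (0:ℝ) 1}, |(k : ℝ) * (x 0 ^ a * x 1 ^ b *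
      (1 - x 0) ^ P * (1 - x 1) ^ R * (1 - x 0 * x 1) ^ m)| ≤ |(k : ℝ)| := by
  intro x hx
  have h0 := hx 0
  have h1 := hx 1
  rw [abs_mul]
  refine mul_le_of_le_one_right (abs_nonneg _) ?_
  have hw0 : 0 ≤ 1 - x 0 * x 1 := by nlinarith [h0.1, h0.2, h1.1, h1.2]
  rcases hw0.lt_or_eq with hw | hw
  · obtain ⟨hT0, hT1⟩ := facesTwo_core_bounds a b P R m h0 h1 hw
    rw [abs_of_nonneg hT0]
    exact hT1.trans (zpow_le_one₀ hw (by nlinarith [h0.1, h1.1]) h)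
  · rw [← hw]
    have ha1 : x 0 ^ a ≤ 1 := pow_le_one₀ h0.1 h0.2
    have hb1 : x 1 ^ b ≤ 1 := pow_le_one₀ h1.1 h1.2
    have hP1 : (1 - x 0) ^ P ≤ 1 := pow_le_one₀ (sub_nonneg.2 h0.2) (by linarith [h0.1])
    have hR1 : (1 - x 1) ^ R ≤ 1 := pow_le_one₀ (sub_nonneg.2 h1.2) (by linarith [h1.1])
    have ha : 0 ≤ x 0 ^ a := pow_nonneg h0.1 a
    have hb : 0 ≤ x 1 ^ b := pow_nonneg h1.1 b
    have hP : 0 ≤ (1 - x 0) ^ P := pow_nonneg (sub_nonneg.2 h0.2) P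
    have hR : 0 ≤ (1 - x 1) ^ R := pow_nonneg (sub_nonneg.2 h1.2) R
    rcases eq_or_ne m 0 with rfl | hm
    · rw [zpow_zero, mul_one, abs_of_nonneg (by positivity)]
      calc x 0 ^ a * x 1 ^ b * (1 - x 0) ^ P * (1 - x 1) ^ R ≤ 1 * 1 * 1 * 1 := by gcongr
        _ = 1 := by ring
    · rw [zero_zpow m hm, mul_zero, abs_zero]
      exact zero_le_one

/-- **Boundedness on the open square** (`≤ |k| ≤ C`). -/
theorem facesTwo_gen_abs_le_Q2 (k : ℚ) (a b P R : ℕ) (m : ℤ) (h : 0 ≤ (P : ℤ) + R + m) {C : ℝ}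
    (hC : |(k : ℝ)| ≤ C) : ∀ x ∈ KZ.unitCube 2, |(k : ℝ) * (x 0 ^ a * x 1 ^ b * (1 - x 0) ^ P *
      (1 - x 1) ^ R * (1 - x 0 * x 1) ^ m)| ≤ C := fun x hx =>
  (facesTwo_gen_abs_le k a b P R m h x (facesTwo_Q2_subset_S2 hx)).trans hC

/-! ### Differentiability and the coordinate fibres -/

/-- `GEN` is differentiable at every point of the open square. -/
theorem facesTwo_gen_differentiableAt (k : ℚ) (a b P R : ℕ) (m : ℤ) {x : Fin 2 → ℝ}
    (hx : x ∈ KZ.unitCube 2) : DifferentiableAt ℝ (fun x => (k : ℝ) * (x 0 ^ a * x 1 ^ b *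
      (1 - x 0) ^ P * (1 - x 1) ^ R * (1 - x 0 * x 1) ^ m)) x := by
  have h : 1 - x 0 * x 1 ≠ 0 := (facesTwo_w_pos hx).ne'
  fun_prop (disch := exact Or.inl h)

/-- Coordinates of a point of the fibre in direction `0`. -/
theorem facesTwo_ins0 (t : ℝ) (y : Fin 1 → ℝ) :
    (Fin.insertNth 0 t y : Fin 2 → ℝ) 0 = t ∧ (Fin.insertNth 0 t y : Fin 2 → ℝ) 1 = y 0 :=
  ⟨by simp, by simp⟩

/-- Coordinates of a point of the fibre in direction `1`. -/
theorem facesTwo_ins1 (t : ℝ) (y : Fin 1 → ℝ) :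
    (Fin.insertNth 1 t y : Fin 2 → ℝ) 0 = y 0 ∧ (Fin.insertNth 1 t y : Fin 2 → ℝ) 1 = t := by
  refine ⟨?_, by simp⟩
  rw [show (1 : Fin 2) = Fin.last 1 from rfl, Fin.insertNth_last']
  simp

/-- The coordinate fibres `t ↦ GEN (insertNth i t y)` (`y` in the open interval) are continuous
on `[0,1]`: the only possibly singular factor `1 - t·y₀` stays `≥ 1 - y₀ > 0`. -/
theorem facesTwo_gen_continuousOn_fibre (k : ℚ) (a b P R : ℕ) (m : ℤ) :
    ∀ (i : Fin 2), ∀ y ∈ KZ.unitCube 1, ContinuousOn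
      (fun t : ℝ => (k : ℝ) * ((Fin.insertNth i t y : Fin 2 → ℝ) 0 ^ a *
        (Fin.insertNth i t y : Fin 2 → ℝ) 1 ^ b * (1 - (Fin.insertNth i t y : Fin 2 → ℝ) 0) ^ P *
        (1 - (Fin.insertNth i t y : Fin 2 → ℝ) 1) ^ R *
        (1 - (Fin.insertNth i t y : Fin 2 → ℝ) 0 * (Fin.insertNth i t y : Fin 2 → ℝ) 1) ^ m))
      (Icc 0 1) := by
  intro i y hy
  have hy0 := hy 0
  fin_cases i
  · simp only [Fin.zero_eta, (facesTwo_ins0 _ y).1, (facesTwo_ins0 _ y).2]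
    refine continuousOn_const.mul ((by fun_prop : ContinuousOn _ _).mul ?_)
    refine ContinuousOn.zpow₀ (by fun_prop) m fun t ht => Or.inl ?_
    have : t * y 0 ≤ 1 * y 0 := by nlinarith [ht.2, hy0.1]
    nlinarith [hy0.2]
  · simp only [Fin.mk_one, (facesTwo_ins1 _ y).1, (facesTwo_ins1 _ y).2]
    refine continuousOn_const.mul ((by fun_prop : ContinuousOn _ _).mul ?_)
    refine ContinuousOn.zpow₀ (by fun_prop) m fun t ht => Or.inl ?_
    have : y 0 * t ≤ y 0 * 1 := by nlinarith [ht.2, hy0.1]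
    nlinarith [hy0.2]

/-! ### Integrability -/

/-- `1/(1 - x₀x₁)` is absolutely integrable on the open square: it is the cubical pull-back of the
`ζ(2)` word `ω₀ω₁` (`TwoPosets.stub_cubicalChart`). -/
theorem facesTwo_integrableOn_inv :
    IntegrableOn (fun x : Fin 2 → ℝ => (1 - x 0 * x 1)⁻¹) (KZ.unitCube 2) := by
  have h1 := (stub_cubicalChart 2 ω2 adm_ω2 1).1
  refine h1.congr_fun (fun x hx => ?_) (KZ.isOpen_unitCube 2).measurableSet
  have hx' : x ∈ KZ.unitCube 2 := hx
  have h0 : x 0 ≠ 0 := (hx' 0).1.ne'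
  have hp1 : pprod x 1 = x 0 * x 1 := by simpa [pprod_zero] using pprod_succ x 0
  simp [cubicalFun, wordFun, cubicalMap, Summit.KontsevichZagierPeriods.MzvKernelInKZ.Negative.ω2,
    Fin.prod_univ_two, pprod_zero, hp1]
  field_simp

/-- **Absolute integrability of `GEN` on the open square** as soon as `m ≥ -(P + R + 1)`:
`|GEN| ≤ |k| (1 - x₀x₁)^{P+R+m} ≤ |k|/(1 - x₀x₁)`. -/
theorem facesTwo_gen_integrableOn (k : ℚ) (a b P R : ℕ) (m : ℤ) (h : -((P : ℤ) + R + 1) ≤ m) :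
    IntegrableOn (fun x => (k : ℝ) * (x 0 ^ a * x 1 ^ b * (1 - x 0) ^ P * (1 - x 1) ^ R *
      (1 - x 0 * x 1) ^ m)) (KZ.unitCube 2) := by
  refine Integrable.mono' (facesTwo_integrableOn_inv.const_mul |(k : ℝ)|) ?_ ?_
  · exact KZ.aestronglyMeasurable_of_isSemialgebraicFunOn (facesTwo_gen_sa_Q2 k a b P R m)
      (KZ.isOpen_unitCube 2).measurableSet
  · refine ae_restrict_of_forall_mem (KZ.isOpen_unitCube 2).measurableSet fun x hx => ?_
    have hw := facesTwo_w_pos hx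
    have h0 : x 0 ∈ Icc (0:ℝ) 1 := Ioo_subset_Icc_self (hx 0)
    have h1 : x 1 ∈ Icc (0:ℝ) 1 := Ioo_subset_Icc_self (hx 1)
    obtain ⟨hT0, hT1⟩ := facesTwo_core_bounds a b P R m h0 h1 hw
    rw [Real.norm_eq_abs, abs_mul, abs_of_nonneg hT0]
    refine mul_le_mul_of_nonneg_left (hT1.trans ?_) (abs_nonneg _)
    rw [← zpow_neg_one]
    exact zpow_le_zpow_right_of_le_one₀ hw (by nlinarith [(hx 0).1, (hx 1).1]) (by omega)

/-- A representation on the open square with integrand `GEN` exists as soon as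
`m ≥ -(P + R + 1)`. -/
theorem facesTwo_gen_rep (k : ℚ) (a b P R : ℕ) (m : ℤ) (h : -((P : ℤ) + R + 1) ≤ m) :
    ∃ r : KZ.IntegralRep 2, r.domain = KZ.unitCube 2 ∧ r.integrand = (fun x => (k : ℝ) *
      (x 0 ^ a * x 1 ^ b * (1 - x 0) ^ P * (1 - x 1) ^ R * (1 - x 0 * x 1) ^ m)) :=
  ⟨⟨KZ.unitCube 2, _, KZ.isSemialgebraic_unitCube 2, facesTwo_gen_sa_Q2 k a b P R m,
    facesTwo_gen_integrableOn k a b P R m h⟩, rfl, rfl⟩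

/-! ### Partial derivatives -/

/-- A partial derivative of a differentiable function is the derivative along the coordinate
line. -/
theorem facesTwo_fderiv_single {g : (Fin 2 → ℝ) → ℝ} {x : Fin 2 → ℝ} (hg : DifferentiableAt ℝ g x)
    (i : Fin 2) {d : ℝ} (hd : HasDerivAt (fun t => g (Function.update x i t)) d (x i)) :
    fderiv ℝ g x (Pi.single i 1) = d := by
  have hg' : HasFDerivAt g (fderiv ℝ g x) (Function.update x i (x i)) := by
    rw [Function.update_eq_self]
    exact hg.hasFDerivAt
  exact (hg'.comp_hasDerivAt (x i) (hasDerivAt_update x i (x i))).unique hd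

/-- **`∂₀ GEN`** on the open square: `∂₀ GEN(k,a,b,P,R,m) = GEN(ka, a-1, b, P, R, m)
- GEN(kP, a, b, P-1, R, m) - GEN(km, a, b+1, P, R, m-1)` (truncated subtraction in the exponents
is harmless: the corresponding coefficient vanishes). -/
theorem facesTwo_gen_fderiv0 (k : ℚ) (a b P R : ℕ) (m : ℤ) {x : Fin 2 → ℝ}
    (hx : x ∈ KZ.unitCube 2) :
    fderiv ℝ (fun x => (k : ℝ) * (x 0 ^ a * x 1 ^ b * (1 - x 0) ^ P * (1 - x 1) ^ R *
      (1 - x 0 * x 1) ^ m)) x (Pi.single 0 1) =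
      ((k * a : ℚ) : ℝ) * (x 0 ^ (a - 1) * x 1 ^ b * (1 - x 0) ^ P * (1 - x 1) ^ R *
        (1 - x 0 * x 1) ^ m) -
      ((k * P : ℚ) : ℝ) * (x 0 ^ a * x 1 ^ b * (1 - x 0) ^ (P - 1) * (1 - x 1) ^ R *
        (1 - x 0 * x 1) ^ m) -
      ((k * m : ℚ) : ℝ) * (x 0 ^ a * x 1 ^ (b + 1) * (1 - x 0) ^ P * (1 - x 1) ^ R *
        (1 - x 0 * x 1) ^ (m - 1)) := by
  have hw : 1 - x 0 * x 1 ≠ 0 := (facesTwo_w_pos hx).ne'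
  refine facesTwo_fderiv_single (facesTwo_gen_differentiableAt k a b P R m hx) 0 ?_
  simp only [Function.update_self, ne_eq, one_ne_zero, not_false_eq_true,
    Function.update_of_ne]
  have e1 : HasDerivAt (fun t : ℝ => t ^ a) ((a : ℝ) * x 0 ^ (a - 1)) (x 0) := hasDerivAt_pow a _
  have e3 : HasDerivAt (fun t : ℝ => (1 - t) ^ P) ((P : ℝ) * (1 - x 0) ^ (P - 1) * (-1)) (x 0) :=
    ((hasDerivAt_id' (x 0)).const_sub 1).pow P
  have e5 : HasDerivAt (fun t : ℝ => (1 - t * x 1) ^ m)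
      ((m : ℝ) * (1 - x 0 * x 1) ^ (m - 1) * (-(1 * x 1))) (x 0) := by
    rw [show (fun t : ℝ => (1 - t * x 1) ^ m) = (fun y : ℝ => y ^ m) ∘ (fun t : ℝ => 1 - t * x 1)
      from rfl]
    exact (hasDerivAt_zpow m (1 - x 0 * x 1) (Or.inl hw)).comp (x 0)
      (((hasDerivAt_id' (x 0)).mul_const (x 1)).const_sub 1)
  have e : HasDerivAt
      (fun t : ℝ => ((k : ℚ) : ℝ) * (t ^ a * x 1 ^ b * (1 - t) ^ P * (1 - x 1) ^ R *
        (1 - t * x 1) ^ m))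
      (((k : ℚ) : ℝ) * ((((a : ℝ) * x 0 ^ (a - 1) * x 1 ^ b * (1 - x 0) ^ P +
          x 0 ^ a * x 1 ^ b * ((P : ℝ) * (1 - x 0) ^ (P - 1) * (-1))) * (1 - x 1) ^ R) *
          (1 - x 0 * x 1) ^ m +
        x 0 ^ a * x 1 ^ b * (1 - x 0) ^ P * (1 - x 1) ^ R *
          ((m : ℝ) * (1 - x 0 * x 1) ^ (m - 1) * (-(1 * x 1))))) (x 0) :=
    ((((e1.mul_const (x 1 ^ b)).fun_mul e3).mul_const ((1 - x 1) ^ R)).fun_mul e5).const_mul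
      ((k : ℚ) : ℝ)
  refine e.congr_deriv ?_
  push_cast
  ring

/-- **`∂₁ GEN`** on the open square: `∂₁ GEN(k,a,b,P,R,m) = GEN(kb, a, b-1, P, R, m)
- GEN(kR, a, b, P, R-1, m) - GEN(km, a+1, b, P, R, m-1)`. -/
theorem facesTwo_gen_fderiv1 (k : ℚ) (a b P R : ℕ) (m : ℤ) {x : Fin 2 → ℝ}
    (hx : x ∈ KZ.unitCube 2) :
    fderiv ℝ (fun x => (k : ℝ) * (x 0 ^ a * x 1 ^ b * (1 - x 0) ^ P * (1 - x 1) ^ R *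
      (1 - x 0 * x 1) ^ m)) x (Pi.single 1 1) =
      ((k * b : ℚ) : ℝ) * (x 0 ^ a * x 1 ^ (b - 1) * (1 - x 0) ^ P * (1 - x 1) ^ R *
        (1 - x 0 * x 1) ^ m) -
      ((k * R : ℚ) : ℝ) * (x 0 ^ a * x 1 ^ b * (1 - x 0) ^ P * (1 - x 1) ^ (R - 1) *
        (1 - x 0 * x 1) ^ m) -
      ((k * m : ℚ) : ℝ) * (x 0 ^ (a + 1) * x 1 ^ b * (1 - x 0) ^ P * (1 - x 1) ^ R *
        (1 - x 0 * x 1) ^ (m - 1)) := by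
  have hw : 1 - x 0 * x 1 ≠ 0 := (facesTwo_w_pos hx).ne'
  refine facesTwo_fderiv_single (facesTwo_gen_differentiableAt k a b P R m hx) 1 ?_
  simp only [Function.update_self, ne_eq, zero_ne_one, not_false_eq_true,
    Function.update_of_ne]
  have e2 : HasDerivAt (fun t : ℝ => t ^ b) ((b : ℝ) * x 1 ^ (b - 1)) (x 1) := hasDerivAt_pow b _
  have e4 : HasDerivAt (fun t : ℝ => (1 - t) ^ R) ((R : ℝ) * (1 - x 1) ^ (R - 1) * (-1)) (x 1) :=
    ((hasDerivAt_id' (x 1)).const_sub 1).pow R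
  have e5 : HasDerivAt (fun t : ℝ => (1 - x 0 * t) ^ m)
      ((m : ℝ) * (1 - x 0 * x 1) ^ (m - 1) * (-(x 0 * 1))) (x 1) := by
    rw [show (fun t : ℝ => (1 - x 0 * t) ^ m) = (fun y : ℝ => y ^ m) ∘ (fun t : ℝ => 1 - x 0 * t)
      from rfl]
    exact (hasDerivAt_zpow m (1 - x 0 * x 1) (Or.inl hw)).comp (x 1)
      (((hasDerivAt_id' (x 1)).const_mul (x 0)).const_sub 1)
  have e : HasDerivAt
      (fun t : ℝ => ((k : ℚ) : ℝ) * (x 0 ^ a * t ^ b * (1 - x 0) ^ P * (1 - t) ^ R *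
        (1 - x 0 * t) ^ m))
      (((k : ℚ) : ℝ) * ((x 0 ^ a * ((b : ℝ) * x 1 ^ (b - 1)) * (1 - x 0) ^ P * (1 - x 1) ^ R +
          x 0 ^ a * x 1 ^ b * (1 - x 0) ^ P * ((R : ℝ) * (1 - x 1) ^ (R - 1) * (-1))) *
          (1 - x 0 * x 1) ^ m +
        x 0 ^ a * x 1 ^ b * (1 - x 0) ^ P * (1 - x 1) ^ R *
          ((m : ℝ) * (1 - x 0 * x 1) ^ (m - 1) * (-(x 0 * 1))))) (x 1) :=
    ((((e2.const_mul (x 0 ^ a)).mul_const ((1 - x 0) ^ P)).fun_mul e4).fun_mul e5).const_mul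
      ((k : ℚ) : ℝ)
  refine e.congr_deriv ?_
  push_cast
  ring

/-! ### Registered sub-goal -/

/-- Registered sub-goal `stub_exactToFacesTwoAux1` of this file: absolute integrability of the
atoms `k x₀^a x₁^b (1-x₀)^P (1-x₁)^R (1-x₀x₁)^m`, `m ≥ -(P + R + 1)`, on the open square
(`facesTwo_gen_integrableOn`). -/
theorem stub_exactToFacesTwoAux1 : ∀ (k : ℚ) (a b P R : ℕ) (m : ℤ), -((P : ℤ) + R + 1) ≤ m → MeasureTheory.IntegrableOn (fun x : Fin 2 → ℝ => (k : ℝ) * (x 0 ^ a * x 1 ^ b * (1 - x 0) ^ P * (1 - x 1) ^ R * (1 - x 0 * x 1) ^ m)) {x : Fin 2 → ℝ | ∀ i, x i ∈ Set.Ioo (0:ℝ) 1} MeasureTheory.volume :=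
  fun k a b P R m h => facesTwo_gen_integrableOn k a b P R m h

end Summit.KontsevichZagierPeriods.DihedralNormalForm.TameBVStokes
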